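import Summits.KontsevichZagierPeriods.KontsevichZagierPeriods.Theorems.LinRedNormalFormArrangementNormalFormSeparateThreeHHKSecIIIPrep
import Summits.KontsevichZagierPeriods.KontsevichZagierPeriods.Theorems.LinRedNormalFormArrangementNormalFormSeparateThreeHHKSecAway

/-!
# The sector theorem of type (III), slope frames: bigraded in `(t, v)`, free in `u`

(Line `janus-bands`, crux `ArrangementNormalForm`, stub `stub_separateHigh`, part `HHKSecIIIa` of
the wall-invariant termwise-split lemma `separateThree_hHk` in base dimension `3` with fibres.)
At a base point `z₁` of the pole plane and a direction `d` in the pole plane, consider the nested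
sector with a GENUINE SLOPE frame `Q = Qy E + Qc c`, `S = Sy E + Sc c` (`Qy Sc − Qc Sy ≠ 0`,
`Qy ≠ 0`, `Qc ≠ 0`; part `HHKSecIIIPrep`). Along it the common denominator is
`t^{Dt} v^{Dv} · ω` (no power of `u`), the numerator is the bigraded sum of the rows
`Hrow a b (u) t^a v^b` and the pieces are the bigraded sums of `Gam i a b`. The density
`𝟙_Y (∑ |Ri i|) m` then has finite integral over the sector for all small scales
(`sector_IIIgen`, registered as `separateThreeHHK_secIIIa`): a non-zero row is a non-zero
polynomial in `u`, bounded below on dyadic intervals near `0`, so `SepHHK.ray_bigraded3`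
integrates `t^a v^b` against the weight; a zero row kills the corresponding rows of all pieces
(bigrading exactness, part `HHKFormsB`); `SepHHK.pieces_bigraded_lt_top` concludes.
-/

noncomputable section

open Set MeasureTheory Filter Topology
open scoped ENNReal

namespace Summit.KontsevichZagierPeriods.ArrangementNormalForm.JanusBands

namespace SepHHK

open SepTwo

/-- The weight without explicit power of `u`. -/
theorem wt3_zero_u (Dt Dv : ℕ) (ωa : ℝ → ℝ → ℝ → ℝ) (Λ' : ℝ → ℝ → ℝ → ℝ≥0∞) (t v u : ℝ) :
    wt3 Dt Dv 0 ωa Λ' t v u =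
      ENNReal.ofReal (t ^ 2 * v / (t ^ Dt * v ^ Dv * ωa t v u)) * Λ' t v u := by
  simp [wt3, phi3]

/-- **The sector theorem of type (III) for genuine slope frames.** See the module docstring. -/
theorem sector_IIIgen {k mL m'' : ℕ} (φ : Fin m'' → (Fin 3 → ℝ) × ℝ)
    (lo hi : Fin k → Fin k ⊕ Atm 3) (a : Fin k → Option (Atm 3))
    (κ : Fin mL → Fin 2 → ℝ) (μ : Fin mL → ℝ) (e : Fin mL → ℕ) (n : ℕ) (l₁ l₂ l₀ : ℝ)
    (N : ℕ) (q : ℕ → MvPolynomial (Fin 2) ℝ) (R : (Fin 3 → ℝ) → ℝ) (Ri : ℕ → (Fin 3 → ℝ) → ℝ)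
    (z₁ : Fin 3 → ℝ)
    (hR : ∀ x, R x = (∑ i ∈ Finset.range N, MvPolynomial.eval (pr2 x) (q i) * lam3 l₁ l₂ l₀ x ^ i) /
      common κ μ e n l₁ l₂ l₀ x)
    (hRi : ∀ i < N, ∀ x, Ri i x = MvPolynomial.eval (pr2 x) (q i) * lam3 l₁ l₂ l₀ x ^ i /
      common κ μ e n l₁ l₂ l₀ x)
    (hRm : Measurable R) (hRim : ∀ i, Measurable (Ri i))
    (hfinY : ∫⁻ x in {x | ∀ j, 0 < rav x (φ j)}, ENNReal.ofReal |R x| * lmass lo hi a (av x) < ∞)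
    (hlam : lam3 l₁ l₂ l₀ z₁ = 0) (d : Fin 3 → ℝ) (hd : lamL l₁ l₂ d = 0) (cw : Fin 2 → ℝ)
    (hdc : d 0 * cw 1 - d 1 * cw 0 ≠ 0)
    {D : ℕ} (hND : N ≤ D + 1) (β : Coef₃ D)
    (hβ : ∀ (i : ℕ) (hi : i < N) (w₁ w₂ : ℝ), MvPolynomial.eval (pr2 z₁ + w₁ • pr2 d + w₂ • cw) (q i) =
      pev₂ (β ⟨i, lt_of_lt_of_le hi hND⟩) w₁ w₂)
    (hβ0 : ∀ i : Fin (D + 1), N ≤ (i : ℕ) → β i = 0)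
    (Qy Qc Sy Sc : ℝ) (hfr : Qy * Sc - Qc * Sy ≠ 0) (hQy : Qy ≠ 0) (hQc : Qc ≠ 0)
    (hκ : ∀ j ∈ thr κ μ e z₁, klin κ j d ≠ 0 ∨ κ j 0 * cw 0 + κ j 1 * cw 1 ≠ 0) :
    ∀ᶠ δt in 𝓝[>] (0 : ℝ), ∀ᶠ δ in 𝓝[>] (0 : ℝ), ∀ᶠ ε in 𝓝[>] (0 : ℝ),
      ∫⁻ z in nsector z₁ d (frameIII l₁ l₂ cw Qy Qc) (frameIII l₁ l₂ cw Sy Sc) δt δ (Ico 0 ε),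
        {x : Fin 3 → ℝ | ∀ j, 0 < rav x (φ j)}.indicator
        (fun x => (∑ i ∈ Finset.range N, ENNReal.ofReal |Ri i x|) * lmass lo hi a (av x)) z < ∞ := by
  set Y : Set (Fin 3 → ℝ) := {x | ∀ j, 0 < rav x (φ j)} with hY
  have hYm : MeasurableSet Y := measurableSet_Y3 φ
  set mm : (Fin 3 → ℝ) → ℝ≥0∞ := fun x => lmass lo hi a (av x) with hmm
  have hm : Measurable mm := measurable_lmass_av lo hi a
  set Q : Fin 3 → ℝ := frameIII l₁ l₂ cw Qy Qc with hQ
  set S : Fin 3 → ℝ := frameIII l₁ l₂ cw Sy Sc with hS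
  have hdet : det3 d Q S ≠ 0 := by
    rw [det3_frameIII l₁ l₂ d hd]
    exact mul_ne_zero (by intro h; apply hfr; linarith) hdc
  have hLQ : lamL l₁ l₂ Q = Qy := lamL_frameIII l₁ l₂ cw Qy Qc
  have hκ' : ∀ j ∈ thr κ μ e z₁, klin κ j d ≠ 0 ∨ klin κ j Q ≠ 0 := fun j hj =>
    (hκ j hj).imp_right fun h => by rw [klin_frameIII]; exact mul_ne_zero hQc h
  have hDu : Du3 κ μ e n l₁ l₂ z₁ d Q = 0 :=
    Du3_eq_zero κ μ e n l₁ l₂ z₁ d Q (Or.inr (Or.inr (by rw [hLQ]; exact hQy))) hκ'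
  -- the regular factor
  set ω : ℝ → ℝ → ℝ → ℝ := omega3 κ μ e n l₁ l₂ z₁ d Q S with hω
  have hωc : Continuous fun p : ℝ × ℝ × ℝ => ω p.1 p.2.1 p.2.2 := continuous_omega3 κ μ e n l₁ l₂ z₁ d Q S
  have hωm : Measurable fun p : ℝ × ℝ × ℝ => ω p.1 p.2.1 p.2.2 := hωc.measurable
  have hω0 : (fun p : ℝ × ℝ × ℝ => ω p.1 p.2.1 p.2.2) 0 ≠ 0 := by
    simp only [hω, Prod.fst_zero, Prod.snd_zero]
    exact omega3_corner_ne_zero κ μ e n l₁ l₂ z₁ d Q S (Or.inr (Or.inr (Or.inl (by rw [hLQ]; exact hQy))))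
      fun j hj => (hκ' j hj).elim Or.inl fun h => Or.inr (Or.inl h)
  obtain ⟨ωlo, hωlo, ωhi, ρ, hρ, hωb⟩ := exists_corner_bounds _ hωc hω0
  set Dt : ℕ := Dt3 κ μ e n z₁ with hDt
  set Dv : ℕ := Dv3 κ μ e n l₁ l₂ z₁ d with hDv
  have hcommon : ∀ t v u : ℝ, 0 ≤ t → 0 ≤ v → 0 ≤ u →
      |common κ μ e n l₁ l₂ l₀ (npt z₁ d Q S t v u)| = t ^ Dt * v ^ Dv * |ω t v u| := by
    intro t v u ht hv hu
    rw [abs_common_npt κ μ e n l₁ l₂ l₀ z₁ d Q S hlam ht hv hu, hDu, pow_zero, mul_one]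
  -- weight data, rows data
  obtain ⟨δ₀, hδ₀, ε₀, hε₀, η₀, hη₀, KΛ, hKΛ, Kn, CΛ, hCΛ, hΛmono, -, -, hΛu⟩ :=
    weight_hyps3 lo hi a z₁ d Q S
  obtain ⟨BΓ, hBΓ0, hBΓ⟩ := exists_Gam_bound β Qy Sy Qc Sc
  obtain ⟨η₂, hη₂, hη₂1, hroot⟩ := exists_rows_rootfree β Qy Sy Qc Sc
  -- sign dichotomy and scales
  have hsign := eventually_in_or_out3 φ z₁ d Q S
  have hcδt : 0 < min (δ₀ / 4) (ρ / 4) := by positivity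
  filter_upwards [hsign, Ioo_mem_nhdsGT hcδt] with δt hsδt hδt
  have hδtpos : 0 < δt := hδt.1
  obtain ⟨hδt0, hδtρ⟩ := lt_min_iff.1 hδt.2
  have h4δt : 4 * δt ≤ δ₀ := by linarith
  have hδtδ₀ : δt ≤ δ₀ := by linarith
  have hcδ : 0 < min (ε₀ / 16) (ρ / 16) := by positivity
  filter_upwards [hsδt, Ioo_mem_nhdsGT hcδ] with δ hsδ hδ
  have hδpos : 0 < δ := hδ.1
  obtain ⟨hδ0, hδρ⟩ := lt_min_iff.1 hδ.2
  have h4δ : 4 * δ ≤ ε₀ := by linarith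
  have hcε : 0 < min (min (η₀ / 16) (ρ / 16)) (η₂ / 4) := by positivity
  filter_upwards [hsδ, Ioo_mem_nhdsGT hcε] with ε hsε hε
  have hεpos : 0 < ε := hε.1
  obtain ⟨hεa, hεη⟩ := lt_min_iff.1 hε.2
  obtain ⟨hε0, hερ⟩ := lt_min_iff.1 hεa
  have h4ε : 4 * ε ≤ η₀ := by linarith
  have h4ε1 : 4 * ε ≤ 1 := by linarith
  -- outside: no mass
  rcases hsε with hin4 | hout
  swap
  · rw [nsector_zero N z₁ d Q S hYm hm hRim hdet fun t ht v hv u hu =>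
      hout t (Ioo_four hδt.1 ht) v (Ioo_four hδ.1 hv) u (Ioo_four hε.1 hu)]
    exact ENNReal.zero_lt_top
  have hin : ∀ t ∈ Ioo (0 : ℝ) δt, ∀ v ∈ Ioo (0 : ℝ) δ, ∀ u ∈ Ioo (0 : ℝ) ε,
      npt z₁ d Q S t v u ∈ Y := fun t ht v hv u hu =>
    hin4 t (Ioo_four hδt.1 ht) v (Ioo_four hδ.1 hv) u (Ioo_four hε.1 hu)
  refine nsector_finite N z₁ d Q S hYm hm hRim hdet hin ?_
  -- the weight
  set ωa : ℝ → ℝ → ℝ → ℝ := fun t v u => |ω t v u| with hωa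
  set Λ' : ℝ → ℝ → ℝ → ℝ≥0∞ := fun t v u => mm (npt z₁ d Q S t v u) with hΛ'
  set W : ℝ → ℝ → ℝ → ℝ≥0∞ := wt3 Dt Dv 0 ωa Λ' with hW
  have hωam : Measurable fun p : ℝ × ℝ × ℝ => ωa p.1 p.2.1 p.2.2 := hωm.abs
  have hWm : Measurable fun p : ℝ × ℝ × ℝ => W p.1 p.2.1 p.2.2 :=
    measurable_wt3 Dt Dv 0 hωam (measurable_lmass_npt lo hi a z₁ d Q S)
  have hωB : ∀ t ∈ Ioo (0 : ℝ) (4 * δt), ∀ v ∈ Ioo (0 : ℝ) (4 * (4 * δ)), ∀ u ∈ Ioo (0 : ℝ) (4 * (4 * ε)),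
      ωlo ≤ ωa t v u ∧ ωa t v u ≤ ωhi := fun t ht v hv u hu =>
    hωb t v u (by rw [abs_of_pos ht.1]; linarith [ht.2])
      (by rw [abs_of_pos hv.1]; linarith [hv.2]) (by rw [abs_of_pos hu.1]; linarith [hu.2])
  have hωB4 : ∀ t ∈ Ioo (0 : ℝ) (4 * δt), ∀ v ∈ Ioo (0 : ℝ) (4 * δ), ∀ u ∈ Ioo (0 : ℝ) (4 * ε),
      ωlo ≤ ωa t v u ∧ ωa t v u ≤ ωhi := fun t ht v hv u hu =>
    hωB t ht v ⟨hv.1, by linarith [hv.2]⟩ u ⟨hu.1, by linarith [hu.2]⟩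
  have hmonoW := wt3_mono Dt Dv 0 hωlo hωB4 KΛ (Λ' := Λ') (hΛmono δt δ ε h4δt h4δ h4ε)
  set K : ℝ≥0∞ := ENNReal.ofReal (4 ^ Dt * 4 ^ Dv * 4 ^ 0 * (ωhi / ωlo)) * KΛ with hK
  have hKne : K ≠ ∞ := ENNReal.mul_ne_top ENNReal.ofReal_ne_top hKΛ
  have hulogW := wt3_ulog Dt Dv 0 hωlo hωB rfl Kn CΛ (Λ' := Λ') (hΛu δt (4 * δ) (4 * ε) hδtδ₀ h4δ h4ε)
  set C : ℝ≥0∞ := ENNReal.ofReal (ωhi / ωlo) * CΛ with hC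
  have hCne : C ≠ ∞ := ENNReal.mul_ne_top ENNReal.ofReal_ne_top hCΛ
  -- the conversion identity on the big box
  have hden : ∀ t ∈ Ioo (0 : ℝ) (4 * δt), ∀ v ∈ Ioo (0 : ℝ) (4 * δ), ∀ u ∈ Ioo (0 : ℝ) (4 * ε),
      |common κ μ e n l₁ l₂ l₀ (npt z₁ d Q S t v u)| = t ^ Dt * v ^ Dv * ωa t v u ∧
        0 < t ^ Dt * v ^ Dv * ωa t v u := by
    intro t ht v hv u hu
    refine ⟨hcommon t v u ht.1.le hv.1.le hu.1.le, mul_pos (mul_pos (pow_pos ht.1 _) (pow_pos hv.1 _)) ?_⟩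
    exact hωlo.trans_le (hωB4 t ht v hv u hu).1
  have hWeq : ∀ t v u, W t v u = ENNReal.ofReal (t ^ 2 * v / (t ^ Dt * v ^ Dv * ωa t v u)) * Λ' t v u :=
    fun t v u => wt3_zero_u Dt Dv ωa Λ' t v u
  have hnumF := fun t v u => num_npt_frameIII N q l₁ l₂ l₀ z₁ d hlam hd cw hND β hβ hβ0 Qy Qc Sy Sc t v u
  have hconvR : ∀ t ∈ Ioo (0 : ℝ) (4 * δt), ∀ v ∈ Ioo (0 : ℝ) (4 * δ), ∀ u ∈ Ioo (0 : ℝ) (4 * ε),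
      ENNReal.ofReal (t ^ 2 * v) * (ENNReal.ofReal |R (npt z₁ d Q S t v u)| * mm (npt z₁ d Q S t v u)) =
        ENNReal.ofReal |∑ a' : Fin (3 * D + 1), ∑ b' : Fin (3 * D + 1),
          Hrow β Qy Sy Qc Sc a' b' u * t ^ (a' : ℕ) * v ^ (b' : ℕ)| * W t v u := by
    intro t ht v hv u hu
    have hnum : (∑ i ∈ Finset.range N, MvPolynomial.eval (pr2 (npt z₁ d Q S t v u)) (q i) *
        lam3 l₁ l₂ l₀ (npt z₁ d Q S t v u) ^ i) = ∑ a' : Fin (3 * D + 1), ∑ b' : Fin (3 * D + 1),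
          Hrow β Qy Sy Qc Sc a' b' u * t ^ (a' : ℕ) * v ^ (b' : ℕ) := by
      rw [(hnumF t v u).2, sum_G3p_eq_rows]
    rw [hR, hWeq]
    exact piece_eq_wt (by have := ht.1.le; have := hv.1.le; positivity) (by rw [hnum])
      (hden t ht v hv u hu).1 (hden t ht v hv u hu).2 _
  have hfin := hfin_of_inside3 z₁ d Q S hm hRm hfinY hdet hin4
  rw [setLIntegral_congr_fun measurableSet_Ioo fun t ht => setLIntegral_congr_fun measurableSet_Ioo
    fun v hv => setLIntegral_congr_fun measurableSet_Ioo fun u hu => hconvR t ht v hv u hu] at hfin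
  -- the rows: non-zero rows are integrable orders
  have hHm : ∀ a' b' : Fin (3 * D + 1), Measurable (Hrow β Qy Sy Qc Sc a' b') := fun a' b' =>
    (continuous_Hrow β Qy Sy Qc Sc a' b').measurable
  have hrowfin : ∀ a' b' : Fin (3 * D + 1), Rrow β Qy Sy Qc Sc a' b' ≠ 0 →
      ∫⁻ t in Ioo 0 δt, ∫⁻ v in Ioo 0 δ, ∫⁻ u in Ioo 0 (4 * ε),
        ENNReal.ofReal (t ^ (a' : ℕ) * v ^ (b' : ℕ)) * W t v u < ∞ := by
    intro a' b' hab
    obtain ⟨h, hh, hle⟩ := exists_pos_lower (f := Hrow β Qy Sy Qc Sc a' b') (by linarith : 2 * ε ≤ 4 * ε)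
      (continuous_Hrow β Qy Sy Qc Sc a' b').continuousOn
      fun u hu => hroot a' b' hab u ⟨by linarith [hu.1], by linarith [hu.2]⟩
    exact ray_bigraded3 W hWm (Hrow β Qy Sy Qc Sc) hHm K hKne Kn C hCne hε.1
      (fun v hv u hu t t' ht htt' ht't ht' => hmonoW t v u t' v u ht htt' ht't ht' hv.1 le_rfl
        (by linarith [hv.1]) hv.2 hu.1 le_rfl (by linarith [hu.1]) hu.2)
      (fun t ht u hu v v' hv hvv' hv'v hv' => hmonoW t v u t v' u ht.1 le_rfl (by linarith [ht.1])
        (by linarith [ht.2]) hv hvv' hv'v hv' hu.1 le_rfl (by linarith [hu.1]) hu.2)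
      (fun t ht v hv u u' hu huu' hu' => hulogW t ht.1 ht.2 v hv.1 (by linarith [hv.2]) u u' hu huu' hu')
      hfin a' b' hh hle
  -- the pieces
  intro i hiR
  have hiN : i < N := Finset.mem_range.1 hiR
  set i' : Fin (D + 1) := ⟨i, lt_of_lt_of_le hiN hND⟩ with hi'
  have hconv : ∀ t ∈ Ioo (0 : ℝ) δt, ∀ v ∈ Ioo (0 : ℝ) δ, ∀ u ∈ Ioo (0 : ℝ) ε,
      ENNReal.ofReal (t ^ 2 * v) * (ENNReal.ofReal |Ri i (npt z₁ d Q S t v u)| * mm (npt z₁ d Q S t v u)) =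
        ENNReal.ofReal |∑ a' : Fin (3 * D + 1), ∑ b' : Fin (3 * D + 1),
          Gam β Qy Sy Qc Sc i' a' b' u * t ^ (a' : ℕ) * v ^ (b' : ℕ)| * W t v u := by
    intro t ht v hv u hu
    have ht4 := Ioo_four hδt.1 ht
    have hv4 := Ioo_four hδ.1 hv
    have hu4 := Ioo_four hε.1 hu
    have hnum : MvPolynomial.eval (pr2 (npt z₁ d Q S t v u)) (q i) * lam3 l₁ l₂ l₀ (npt z₁ d Q S t v u) ^ i =
        ∑ a' : Fin (3 * D + 1), ∑ b' : Fin (3 * D + 1),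
          Gam β Qy Sy Qc Sc i' a' b' u * t ^ (a' : ℕ) * v ^ (b' : ℕ) := by
      rw [(hnumF t v u).1 i hiN, G3p_eq_sum_Gam]
    rw [hRi i hiN, hWeq]
    exact piece_eq_wt (by have := ht.1.le; have := hv.1.le; positivity) (by rw [hnum])
      (hden t ht4 v hv4 u hu4).1 (hden t ht4 v hv4 u hu4).2 _
  rw [setLIntegral_congr_fun measurableSet_Ioo fun t ht => setLIntegral_congr_fun measurableSet_Ioo
    fun v hv => setLIntegral_congr_fun measurableSet_Ioo fun u hu => hconv t ht v hv u hu]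
  have hpieces := pieces_bigraded_lt_top W hWm (Gam β Qy Sy Qc Sc i')
    (fun a' b' => (continuous_Gam β Qy Sy Qc Sc i' a' b').measurable) hBΓ0 measurableSet_Ioo
    measurableSet_Ioo (η := 4 * ε) (fun t ht => ht.1.le) (fun v hv => hv.1.le)
    (fun a' b' u hu => hBΓ i' a' b' u ⟨hu.1.le, by linarith [hu.2]⟩)
    (fun a' b' => by
      by_cases hab : Rrow β Qy Sy Qc Sc a' b' = 0
      · exact Or.inl fun u _ => Gam_zero_of_Hrow_zero β hfr a' b' one_pos
          (fun u _ => Hrow_zero_of_Rrow_zero β Qy Sy Qc Sc a' b' hab u) i' u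
      · exact Or.inr (hrowfin a' b' hab))
    (A := Ioo 0 δt) (Bv := Ioo 0 δ)
  refine lt_of_le_of_lt (lintegral_mono fun t => lintegral_mono fun v => ?_) hpieces
  exact lintegral_mono_set (Ioo_subset_Ioo le_rfl (by linarith))

end SepHHK

/-- **The sector theorem of type (III) for genuine slope frames** (registered part of
`stub_separateHigh`, base dimension `3` with fibres; consequence of `SepHHK.sector_IIIgen`): at a
base point of the pole plane, along the nested sector at a pole-plane direction `d` with a genuine
slope frame, the density of the Taylor pieces against the fibre mass has finite integral for all
small scales. -/
theorem separateThreeHHK_secIIIa (k mL m'' : ℕ) (φ : Fin m'' → (Fin 3 → ℝ) × ℝ) (lo hi : Fin k → Fin k ⊕ ((Fin 3 → ℚ) × ℚ)) (a : Fin k → Option ((Fin 3 → ℚ) × ℚ)) (κ : Fin mL → Fin 2 → ℝ) (μ : Fin mL → ℝ) (e : Fin mL → ℕ) (n : ℕ) (l₁ l₂ l₀ : ℝ) (N : ℕ) (q : ℕ → MvPolynomial (Fin 2) ℝ) (R : (Fin 3 → ℝ) → ℝ) (Ri : ℕ → (Fin 3 → ℝ) → ℝ) (z₁ : Fin 3 →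 ℝ) (hR : ∀ x, R x = (∑ i ∈ Finset.range N, MvPolynomial.eval (SepHHK.pr2 x) (q i) * SepHHK.lam3 l₁ l₂ l₀ x ^ i) / SepHHK.common κ μ e n l₁ l₂ l₀ x) (hRi : ∀ i < N, ∀ x, Ri i x = MvPolynomial.eval (SepHHK.pr2 x) (q i) * SepHHK.lam3 l₁ l₂ l₀ x ^ i / SepHHK.common κ μ e n l₁ l₂ l₀ x) (hRm : Measurable R) (hRim : ∀ i, Measurable (Ri i)) (hfinY : MeasureTheory.lintegral (MeasureTheory.volume.restrict {x | ∀ j, 0 < SepHHK.rav x (φ j)}) (fun x => ENNReal.ofReal |R x| * SepTwo.lmass lo hi a (SepTwo.av x)) < ⊤) (hlam : SepHHK.lam3 l₁ l₂ l₀ z₁ = 0) (d : Fin 3 → ℝ) (hd : SepHHK.lamL l₁ l₂ d = 0) (cw : Fin 2 → ℝ) (hdc : d 0 * cw 1 - d 1 * cw 0 ≠ 0) (D : ℕ) (hND : N ≤ D + 1) (β : Fin (D + 1) → Fin (D + 1) → Fin (D + 1) → ℝ) (hβ : ∀ (i : ℕ) (hi : i < N) (w₁ w₂ : ℝ), MvPolynomial.eval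 (SepHHK.pr2 z₁ + w₁ • SepHHK.pr2 d + w₂ • cw) (q i) = SepTwo.pev₂ (β ⟨i, lt_of_lt_of_le hi hND⟩) w₁ w₂) (hβ0 : ∀ i : Fin (D + 1), N ≤ (i : ℕ) → β i = 0) (Qy Qc Sy Sc : ℝ) (hfr : Qy * Sc - Qc * Sy ≠ 0) (hQy : Qy ≠ 0) (hQc : Qc ≠ 0) (hκ : ∀ j ∈ SepHHK.thr κ μ e z₁, SepHHK.klin κ j d ≠ 0 ∨ κ j 0 * cw 0 + κ j 1 * cw 1 ≠ 0) : ∀ᶠ δt in nhdsWithin (0 : ℝ) (Set.Ioi 0), ∀ᶠ δ in nhdsWithin (0 : ℝ) (Set.Ioi 0), ∀ᶠ ε in nhdsWithin (0 : ℝ) (Set.Ioi 0), MeasureTheory.lintegral (MeasureTheory.volume.restrict (SepHHK.nsector z₁ d (SepHHK.frameIII l₁ l₂ cw Qy Qc) (SepHHK.frameIII l₁ l₂ cw Sy Sc) δt δ (Set.Ico 0 ε))) (fun z => {x : Fin 3 → ℝ | ∀ j, 0 < SepHHK.rav x (φ j)}.indicator (fun x => (∑ i ∈ Finset.range N, ENNReal.ofReal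 |Ri i x|) * SepTwo.lmass lo hi a (SepTwo.av x)) z) < ⊤ := by
  exact SepHHK.sector_IIIgen φ lo hi a κ μ e n l₁ l₂ l₀ N q R Ri z₁ hR hRi hRm hRim hfinY hlam d hd cw hdc hND β hβ hβ0 Qy Qc Sy Sc hfr hQy hQc hκ

end Summit.KontsevichZagierPeriods.ArrangementNormalForm.JanusBands
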